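import Summits.KontsevichZagierPeriods.KontsevichZagierPeriods.Theorems.KzOnePeriodsBakerClasses

/-!
# KontsevichZagierPeriods — corpus instance G0-17 in the kernel: the cyclotomic units `1 + ζ₅ᵏ` (relation space exactly 3)

Cell pub-kz1p (KZ 1-periods), seat b2b-kz1p-1, helper of the rung-1 item; continuation of
`KzOnePeriodsBakerClasses.lean` (Baker's theorem, HW Prop. 15.10, PROVED in the tree as
`linearIndependent_one_twoPiI_log` / `qbarLinearIndependent_one_twoPiI_log`).  Corpus case `G0-17-cyclotomic-5-units` of
`numerics/kz1p/tests/g0_corpus.json`: `K = ℚ(ζ₅)`, periods the principal values `Lₖ = Log(1 + ζ₅ᵏ) = ∫₁^{1+ζ₅ᵏ} dx/x`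
(`k = 1, …, 4`, straight paths) and `2πi`; expected verdict "relation space 3" (the cyclotomic units `1 + ζ₅ᵏ` generate a
group of rank `r₁ + r₂ − 1 = 1` modulo `μ₁₀`, so the exponent lattice has rank `4 − 1 = 3`, and Baker gives nothing more).
Up to now this verdict was a certificate replay with Baker entering as the cited hypothesis; here it is a KERNEL THEOREM:

* `log_one_add_zeta_five`, `…_sq`, `…_pow_three`, `…_pow_four` — the exact principal values `L₁ = log φ + πi/5`,
  `L₂ = −log φ + 2πi/5`, `L₃ = −log φ − 2πi/5`, `L₄ = log φ − πi/5` (`φ` the golden ratio; `1 + e^{2iθ} = 2cos θ·e^{iθ}`,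
  `2cos(π/5) = φ`, `2cos(2π/5) = φ⁻¹`);
* `cyclotomicFive_log_relations` — the three relations `L₁ + L₂ + L₃ + L₄ = 0`, `5L₁ − 5L₄ = 2πi`, `5L₂ − 5L₃ = 2·2πi`;
* `qbarLinearIndependent_one_twoPiI_log_goldenRatio` — Baker for the single unit `φ` (`φ > 1` is no root of unity):
  `1, 2πi, log φ` are `ℚ̄`-linearly independent;
* `finrank_span_cyclotomicFive_logs` — the `ℚ̄`-span of `L₁, L₂, L₃, L₄, 2πi` has dimension EXACTLY `2` (basis `2πi, log φ`),
  and `finrank_relations_cyclotomicFive_logs` — the space of `ℚ̄`-linear relations among them (the kernel of the evaluation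
  map `ℚ̄⁵ → ℂ`, `ℚ̄ = algebraicClosure ℚ ℂ`) has dimension EXACTLY `3` (rank–nullity).

`ζ₅ = cexp (2πi/5)` is written out in every statement (helper files carry no definitions).
[cite: HuberWustholz2022, Prop 15.10 p.150] [cite: Baker1975, Thm 2.1]
-/

namespace Summit.KontsevichZagierPeriods.KzOnePeriods

open Literature.NumberTheory.Transcendental
open Complex

section CyclotomicFive

open Polynomial
open Real (goldenRatio goldenConj)

/-- `1 + e^{2iθ} = 2 cos θ · e^{iθ}`. [folklore] -/
theorem one_add_exp_two_mul_I (θ : ℝ) :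
    1 + cexp (2 * θ * I) = 2 * Real.cos θ * cexp (θ * I) := by
  rw [Complex.ofReal_cos, Complex.two_cos, add_mul, ← Complex.exp_add, ← Complex.exp_add]
  have h1 : (θ : ℂ) * I + θ * I = 2 * θ * I := by ring
  have h2 : -(θ : ℂ) * I + θ * I = 0 := by ring
  rw [h1, h2, Complex.exp_zero, add_comm]

/-- `2 cos(π/5) = φ = (1 + √5)/2`, the golden ratio (`Real.cos_pi_div_five`). [folklore] -/
theorem two_mul_cos_pi_div_five : 2 * Real.cos (Real.pi / 5) = goldenRatio := by
  rw [Real.cos_pi_div_five, Real.goldenRatio]; ring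

/-- `2 cos(2π/5) = φ⁻¹ = (√5 − 1)/2`. [folklore] -/
theorem two_mul_cos_two_pi_div_five : 2 * Real.cos (2 * Real.pi / 5) = goldenRatio⁻¹ := by
  rw [show 2 * Real.pi / 5 = 2 * (Real.pi / 5) by ring, Real.cos_two_mul, Real.cos_pi_div_five,
    Real.inv_goldenRatio, Real.goldenConj]
  have h5 : Real.sqrt 5 ^ 2 = 5 := Real.sq_sqrt (by norm_num)
  linear_combination (1 / 4 : ℝ) * h5

/-- `Log(1 + ζ₅) = log φ + πi/5` (`1 + ζ₅ = φ·e^{πi/5}`, principal logarithm). [folklore] -/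
theorem log_one_add_zeta_five :
    log (1 + cexp (2 * Real.pi * I / 5)) = Real.log goldenRatio + Real.pi / 5 * I := by
  have h : cexp (2 * Real.pi * I / 5) = cexp (2 * ((Real.pi / 5 : ℝ) : ℂ) * I) := by
    push_cast; ring_nf
  have hc : (2 : ℂ) * (Real.cos (Real.pi / 5) : ℝ) = ((goldenRatio : ℝ) : ℂ) := by
    rw [← two_mul_cos_pi_div_five]; push_cast; ring
  rw [h, one_add_exp_two_mul_I, hc, Complex.log_ofReal_mul Real.goldenRatio_pos (Complex.exp_ne_zero _),
    Complex.log_exp]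
  · push_cast; ring
  · simp; linarith [Real.pi_pos]
  · simp; linarith [Real.pi_pos]

/-- `Log(1 + ζ₅²) = −log φ + 2πi/5` (`1 + ζ₅² = φ⁻¹·e^{2πi/5}`). [folklore] -/
theorem log_one_add_zeta_five_sq :
    log (1 + cexp (2 * Real.pi * I / 5) ^ 2) = -Real.log goldenRatio + 2 * Real.pi / 5 * I := by
  have h : cexp (2 * Real.pi * I / 5) ^ 2 = cexp (2 * ((2 * Real.pi / 5 : ℝ) : ℂ) * I) := by
    rw [← Complex.exp_nat_mul]; push_cast; ring_nf
  have hc : (2 : ℂ) * (Real.cos (2 * Real.pi / 5) : ℝ) = ((goldenRatio⁻¹ : ℝ) : ℂ) := by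
    rw [← two_mul_cos_two_pi_div_five]; push_cast; ring
  rw [h, one_add_exp_two_mul_I, hc,
    Complex.log_ofReal_mul (inv_pos.mpr Real.goldenRatio_pos) (Complex.exp_ne_zero _),
    Complex.log_exp, Real.log_inv]
  · push_cast; ring
  · simp; linarith [Real.pi_pos]
  · simp; linarith [Real.pi_pos]

/-- `Log(1 + ζ₅³) = −log φ − 2πi/5` (`ζ₅³ = e^{−4πi/5}`, `1 + ζ₅³ = φ⁻¹·e^{−2πi/5}`). [folklore] -/
theorem log_one_add_zeta_five_pow_three :
    log (1 + cexp (2 * Real.pi * I / 5) ^ 3) = -Real.log goldenRatio - 2 * Real.pi / 5 * I := by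
  have h : cexp (2 * Real.pi * I / 5) ^ 3 = cexp (2 * ((-(2 * Real.pi / 5) : ℝ) : ℂ) * I) := by
    rw [← Complex.exp_nat_mul]
    have : ((3 : ℕ) : ℂ) * (2 * Real.pi * I / 5)
        = 2 * ((-(2 * Real.pi / 5) : ℝ) : ℂ) * I + 2 * Real.pi * I := by
      push_cast; ring
    rw [this, Complex.exp_add, Complex.exp_two_pi_mul_I, mul_one]
  have hc : (2 : ℂ) * (Real.cos (-(2 * Real.pi / 5)) : ℝ) = ((goldenRatio⁻¹ : ℝ) : ℂ) := by
    rw [Real.cos_neg, ← two_mul_cos_two_pi_div_five]; push_cast; ring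
  rw [h, one_add_exp_two_mul_I, hc,
    Complex.log_ofReal_mul (inv_pos.mpr Real.goldenRatio_pos) (Complex.exp_ne_zero _),
    Complex.log_exp, Real.log_inv]
  · push_cast; ring
  · simp; linarith [Real.pi_pos]
  · simp; linarith [Real.pi_pos]

/-- `Log(1 + ζ₅⁴) = log φ − πi/5` (`ζ₅⁴ = e^{−2πi/5}`, `1 + ζ₅⁴ = φ·e^{−πi/5}`). [folklore] -/
theorem log_one_add_zeta_five_pow_four :
    log (1 + cexp (2 * Real.pi * I / 5) ^ 4) = Real.log goldenRatio - Real.pi / 5 * I := by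
  have h : cexp (2 * Real.pi * I / 5) ^ 4 = cexp (2 * ((-(Real.pi / 5) : ℝ) : ℂ) * I) := by
    rw [← Complex.exp_nat_mul]
    have : ((4 : ℕ) : ℂ) * (2 * Real.pi * I / 5)
        = 2 * ((-(Real.pi / 5) : ℝ) : ℂ) * I + 2 * Real.pi * I := by
      push_cast; ring
    rw [this, Complex.exp_add, Complex.exp_two_pi_mul_I, mul_one]
  have hc : (2 : ℂ) * (Real.cos (-(Real.pi / 5)) : ℝ) = ((goldenRatio : ℝ) : ℂ) := by
    rw [Real.cos_neg, ← two_mul_cos_pi_div_five]; push_cast; ring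
  rw [h, one_add_exp_two_mul_I, hc, Complex.log_ofReal_mul Real.goldenRatio_pos (Complex.exp_ne_zero _),
    Complex.log_exp]
  · push_cast; ring
  · simp; linarith [Real.pi_pos]
  · simp; linarith [Real.pi_pos]

/-- **G0-17, the three obvious relations** (moves (A)(B) of HW: additivity over the components and the loop around `0`):
with `Lₖ = Log(1 + ζ₅ᵏ)`, `L₁ + L₂ + L₃ + L₄ = 0` (`∏ₖ (1 + ζ₅ᵏ) = Φ₅(−1) = 1`), `5L₁ − 5L₄ = 2πi`, `5L₂ − 5L₃ = 2·2πi`.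
[HW 2022, (A)(B) p.120] [folklore] -/
theorem cyclotomicFive_log_relations :
    log (1 + cexp (2 * Real.pi * I / 5)) + log (1 + cexp (2 * Real.pi * I / 5) ^ 2)
        + log (1 + cexp (2 * Real.pi * I / 5) ^ 3) + log (1 + cexp (2 * Real.pi * I / 5) ^ 4) = 0 ∧
      5 * log (1 + cexp (2 * Real.pi * I / 5)) - 5 * log (1 + cexp (2 * Real.pi * I / 5) ^ 4)
        = 2 * Real.pi * I ∧
      5 * log (1 + cexp (2 * Real.pi * I / 5) ^ 2) - 5 * log (1 + cexp (2 * Real.pi * I / 5) ^ 3)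
        = 2 * (2 * Real.pi * I) := by
  rw [log_one_add_zeta_five, log_one_add_zeta_five_sq, log_one_add_zeta_five_pow_three,
    log_one_add_zeta_five_pow_four]
  refine ⟨by ring, by ring, by ring⟩

/-- The golden ratio is algebraic (a root of `X² − X − 1`). [folklore] -/
theorem isAlgebraic_goldenRatio : IsAlgebraic ℚ goldenRatio := by
  refine ⟨X ^ 2 - X - 1, fun h => ?_, ?_⟩
  · have := congr_arg (Polynomial.eval 0) h
    simp at this
  · simp [Real.goldenRatio_sq]

/-- **Baker for the single unit `φ`**: `1, 2πi, log φ` are `ℚ̄`-linearly independent (`φ > 1` is not a root of unity,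
so `linearIndependent_one_twoPiI_log` with `n = 1` applies). [HW 2022, Prop 15.10 p.150] [cite: Baker1975, Thm 2.1] -/
theorem qbarLinearIndependent_one_twoPiI_log_goldenRatio :
    QbarLinearIndependent ![(1 : ℂ), 2 * Real.pi * I, ((Real.log goldenRatio : ℝ) : ℂ)] := by
  have h := qbarLinearIndependent_one_twoPiI_log ![((goldenRatio : ℝ) : ℂ)]
    (fun i => by
      fin_cases i
      simpa using isAlgebraic_goldenRatio.algebraMap (A := ℂ))
    (fun i => by
      have h0 : ((goldenRatio : ℝ) : ℂ) ≠ 0 := by exact_mod_cast Real.goldenRatio_ne_zero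
      fin_cases i
      simpa using h0)
    (fun k hk => by
      rw [Fin.prod_univ_one] at hk
      simp only [Matrix.cons_val_zero] at hk
      have hk' : (goldenRatio : ℝ) ^ k 0 = 1 := by exact_mod_cast hk
      have h0 := (zpow_eq_one_iff_right₀ Real.goldenRatio_pos.le Real.one_lt_goldenRatio.ne').mp hk'
      funext i
      fin_cases i
      exact h0)
  convert h using 2
  funext i
  fin_cases i <;> simp [Complex.ofReal_log Real.goldenRatio_pos.le]

/-- `2πi, log φ` are `ℚ̄`-linearly independent (sub-family). [HW 2022, Prop 15.10 p.150] [cite: Baker1975, Thm 2.1] -/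
theorem linearIndependent_twoPiI_log_goldenRatio :
    LinearIndependent (algebraicClosure ℚ ℂ) ![2 * Real.pi * I, ((Real.log goldenRatio : ℝ) : ℂ)] := by
  have h := (qbarLinearIndependent_iff _).mp qbarLinearIndependent_one_twoPiI_log_goldenRatio
  convert h.comp ![(1 : Fin 3), 2] (by decide) using 1
  funext i
  fin_cases i <;> simp

/-- The `ℚ̄`-span of the five periods of G0-17 equals the `ℚ̄`-span of `2πi, log φ` (each `Log(1 + ζ₅ᵏ)` is
`±log φ + (rational)·2πi`; conversely `log φ = (L₁ + L₄)/2`). [folklore] -/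
theorem span_cyclotomicFive_logs :
    Submodule.span (algebraicClosure ℚ ℂ)
        (Set.range ![log (1 + cexp (2 * Real.pi * I / 5)), log (1 + cexp (2 * Real.pi * I / 5) ^ 2),
          log (1 + cexp (2 * Real.pi * I / 5) ^ 3), log (1 + cexp (2 * Real.pi * I / 5) ^ 4),
          2 * Real.pi * I])
      = Submodule.span (algebraicClosure ℚ ℂ)
          (Set.range ![2 * Real.pi * I, ((Real.log goldenRatio : ℝ) : ℂ)]) := by
  set K := algebraicClosure ℚ ℂ with hK
  have hmul : ∀ (S : Submodule K ℂ) (c : ℂ), c ∈ K → ∀ z ∈ S, c * z ∈ S := fun S c hc z hz => by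
    simpa [IntermediateField.smul_def] using S.smul_mem (⟨c, hc⟩ : K) hz
  have h10 : (10 : ℂ)⁻¹ ∈ K := inv_mem (by exact_mod_cast natCast_mem K 10)
  have h5 : (5 : ℂ)⁻¹ ∈ K := inv_mem (by exact_mod_cast natCast_mem K 5)
  have h2 : (2 : ℂ)⁻¹ ∈ K := inv_mem (by exact_mod_cast natCast_mem K 2)
  have hneg : (-1 : ℂ) ∈ K := neg_mem (one_mem K)
  apply le_antisymm
  · set U := Submodule.span K (Set.range ![2 * Real.pi * I, ((Real.log goldenRatio : ℝ) : ℂ)]) with hU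
    have hpi : (2 * Real.pi * I : ℂ) ∈ U := Submodule.subset_span ⟨0, by simp⟩
    have hlog : ((Real.log goldenRatio : ℝ) : ℂ) ∈ U := Submodule.subset_span ⟨1, by simp⟩
    have m1 : log (1 + cexp (2 * Real.pi * I / 5)) ∈ U := by
      rw [log_one_add_zeta_five,
        show (Real.log goldenRatio : ℂ) + Real.pi / 5 * I
          = Real.log goldenRatio + (10 : ℂ)⁻¹ * (2 * Real.pi * I) by ring]
      exact add_mem hlog (hmul U _ h10 _ hpi)
    have m2 : log (1 + cexp (2 * Real.pi * I / 5) ^ 2) ∈ U := by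
      rw [log_one_add_zeta_five_sq,
        show -(Real.log goldenRatio : ℂ) + 2 * Real.pi / 5 * I
          = (-1 : ℂ) * Real.log goldenRatio + (5 : ℂ)⁻¹ * (2 * Real.pi * I) by ring]
      exact add_mem (hmul U _ hneg _ hlog) (hmul U _ h5 _ hpi)
    have m3 : log (1 + cexp (2 * Real.pi * I / 5) ^ 3) ∈ U := by
      rw [log_one_add_zeta_five_pow_three,
        show -(Real.log goldenRatio : ℂ) - 2 * Real.pi / 5 * I
          = (-1 : ℂ) * Real.log goldenRatio + (-1 : ℂ) * ((5 : ℂ)⁻¹ * (2 * Real.pi * I)) by ring]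
      exact add_mem (hmul U _ hneg _ hlog) (hmul U _ hneg _ (hmul U _ h5 _ hpi))
    have m4 : log (1 + cexp (2 * Real.pi * I / 5) ^ 4) ∈ U := by
      rw [log_one_add_zeta_five_pow_four,
        show (Real.log goldenRatio : ℂ) - Real.pi / 5 * I
          = Real.log goldenRatio + (-1 : ℂ) * ((10 : ℂ)⁻¹ * (2 * Real.pi * I)) by ring]
      exact add_mem hlog (hmul U _ hneg _ (hmul U _ h10 _ hpi))
    rw [Submodule.span_le, Set.range_subset_iff]
    intro i
    fin_cases i <;> simp [m1, m2, m3, m4, hpi]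
  · set V := Submodule.span K
        (Set.range ![log (1 + cexp (2 * Real.pi * I / 5)), log (1 + cexp (2 * Real.pi * I / 5) ^ 2),
          log (1 + cexp (2 * Real.pi * I / 5) ^ 3), log (1 + cexp (2 * Real.pi * I / 5) ^ 4),
          2 * Real.pi * I]) with hV
    have v0 : log (1 + cexp (2 * Real.pi * I / 5)) ∈ V := Submodule.subset_span ⟨0, by simp⟩
    have v3 : log (1 + cexp (2 * Real.pi * I / 5) ^ 4) ∈ V := Submodule.subset_span ⟨3, by simp⟩
    have v4 : (2 * Real.pi * I : ℂ) ∈ V := Submodule.subset_span ⟨4, by simp⟩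
    have hlog : ((Real.log goldenRatio : ℝ) : ℂ) ∈ V := by
      have : ((Real.log goldenRatio : ℝ) : ℂ)
          = (2 : ℂ)⁻¹ * (log (1 + cexp (2 * Real.pi * I / 5)) + log (1 + cexp (2 * Real.pi * I / 5) ^ 4)) := by
        rw [log_one_add_zeta_five, log_one_add_zeta_five_pow_four]; ring
      rw [this]
      exact hmul V _ h2 _ (add_mem v0 v3)
    rw [Submodule.span_le, Set.range_subset_iff]
    intro i
    fin_cases i <;> simp [v4, hlog]

/-- **G0-17, period space**: the `ℚ̄`-span of `Log(1 + ζ₅), Log(1 + ζ₅²), Log(1 + ζ₅³), Log(1 + ζ₅⁴), 2πi` has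
dimension EXACTLY `2` (basis `2πi, log φ`) — the `𝔾ₘ`-rank of the cyclotomic units `1 + ζ₅ᵏ` is `1` and Baker's theorem
(HW Prop. 15.10, `δ = 1 + 1 + 1` with the algebraic period `1` not in this span) gives no further collapse.
[HW 2022, Prop 15.10 p.150] [cite: Baker1975, Thm 2.1] -/
theorem finrank_span_cyclotomicFive_logs :
    Module.finrank (algebraicClosure ℚ ℂ)
      (Submodule.span (algebraicClosure ℚ ℂ)
        (Set.range ![log (1 + cexp (2 * Real.pi * I / 5)), log (1 + cexp (2 * Real.pi * I / 5) ^ 2),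
          log (1 + cexp (2 * Real.pi * I / 5) ^ 3), log (1 + cexp (2 * Real.pi * I / 5) ^ 4),
          2 * Real.pi * I])) = 2 := by
  rw [span_cyclotomicFive_logs, finrank_span_eq_card linearIndependent_twoPiI_log_goldenRatio,
    Fintype.card_fin]

/-- **G0-17 ("relation space 3")**: the space of `ℚ̄`-linear relations
`{β ∈ ℚ̄⁵ : β₁ Log(1 + ζ₅) + β₂ Log(1 + ζ₅²) + β₃ Log(1 + ζ₅³) + β₄ Log(1 + ζ₅⁴) + β₅·2πi = 0}`
(the kernel of the evaluation map `ℚ̄⁵ → ℂ`, `ℚ̄ = algebraicClosure ℚ ℂ`) has dimension EXACTLY `3`: it contains the three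
relations of `cyclotomicFive_log_relations`, and by rank–nullity with `finrank_span_cyclotomicFive_logs` nothing more.
KERNEL THEOREM (was: certificate replay + Baker as the cited hypothesis, cell pub-kz1p corpus case G0-17).
[HW 2022, Prop 15.10 p.150] [cite: Baker1975, Thm 2.1] -/
theorem finrank_relations_cyclotomicFive_logs :
    Module.finrank (algebraicClosure ℚ ℂ)
      (LinearMap.ker (Fintype.linearCombination (algebraicClosure ℚ ℂ)
        ![log (1 + cexp (2 * Real.pi * I / 5)), log (1 + cexp (2 * Real.pi * I / 5) ^ 2),
          log (1 + cexp (2 * Real.pi * I / 5) ^ 3), log (1 + cexp (2 * Real.pi * I / 5) ^ 4),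
          2 * Real.pi * I])) = 3 := by
  have h := LinearMap.finrank_range_add_finrank_ker
    (Fintype.linearCombination (algebraicClosure ℚ ℂ)
      ![log (1 + cexp (2 * Real.pi * I / 5)), log (1 + cexp (2 * Real.pi * I / 5) ^ 2),
        log (1 + cexp (2 * Real.pi * I / 5) ^ 3), log (1 + cexp (2 * Real.pi * I / 5) ^ 4),
        2 * Real.pi * I])
  rw [Fintype.range_linearCombination, finrank_span_cyclotomicFive_logs, Module.finrank_fin_fun] at h
  omega

end CyclotomicFive

end Summit.KontsevichZagierPeriods.KzOnePeriods
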